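import Literature.Computation.Certificates.ConicCertificateLayoutNegSplit
import Literature.Computation.Certificates.ConicCertificateLayoutIntervalBox

/-!
# Kernel-replayable layout: the INTERVAL-DATA box claim of a lower certificate WITH NEGATIVE-PART SPLITS

Topic `Literature/Computation/Certificates`; third sibling of `ConicCertificateLayoutIntervalBox` (box claim
over Gram / dyadic-eig multipliers, `LowerCertBox`) and `ConicCertificateLayoutNegSplit` (split multipliers
`Z_k = P_k − W_k W_kᵀ` with client-vouched operator bounds `x̄_k`, `LowerCertNS`) = certnum
`sdp/FORMAT-problem1-interval-DRAFT.md` v0.95 §4 (ii) last clause «negsplit blocks `|P_k − W_k W_kᵀ|` at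
those entries»: a `certsdp-conic/1` listing BOTH `interval_box` and `neg_split` over a `certsdp-problem/1`
listing `interval_data` whose blocks carry `lambda_max_bound` — the composition the producer emits
(certnum-sdp-1, `certsdp.aposteriori` 0.4.0.dev1: the box numbers are recomputed with `Z_k = P_k − W_k W_kᵀ`
on split blocks).  The variation constants are the interval format's with the SPLIT multipliers (`L_v`,
`L_β`, `box_penalty = L_β + Σ_{v≠u} ρ_v L_v`, `lower_bound_box = lower_bound − box_penalty`); the split
penalty `Σ_k x̄_k ‖W_rows,k‖²_F / 4^{K_k}` is instance-independent because `x̄_k`, like `ρ_v` and `τ_k`, is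
UNIFORM over the box (FORMAT §2).  `check : Bool` = `LowerCertNS.checkWith` ∧ §4 (v) «`ρ_v = none ⇒
L_v = 0`» ∧ §4 (iii) both sub-claims EQUAL their recomputation (`check = checkWith … Zm` by `rfl`, for
two-stage kernel replays); `sound`: `check = true ⇒ lower_bound_box ≤ c′·y + c₀′` for EVERY instance `d′`
of the box and every `y` feasible for `d′` with the declared trace AND operator bounds.
SOURCE: [Jansson2007] Thm 4.1 (a), p. 8 («The primal optimal value is bounded from below by
f̲_p := ⟨ỹ, b⟩ + ⟨d̲⁻, x̄⟩»), remark after (4.3), p. 9 («If interval arithmetic is used, then the input data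
A,b,c may be intervals, and we obtain a lower bound for each instance within the interval data») and
Cor 6.1 (a), p. 13 (hypothesis (ii) `X(ε) ≤ x̄·I`; held text `paper:arxiv-0707.4366` p0008/p0009/p0013);
[JanssonChaykinKeil2008] Thm 3.2.  MECHANISM: a COROLLARY of `JanssonChaykinKeil.lmiForm_bound_negSplit`
applied to the INSTANCE with its own exact residuals, weakened by `|r_v(d′) − r_v(d)| ≤ L_v`,
`|β(d′) − β(d)| ≤ L_β`.  DEVIATIONS from print: inequality (LMI) form, explicit a-priori bounds, entrywise
box, real instances, pinned equalities (soundness uses `≤`).  NOT COVERED: JSON grammar, `requires`,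
verdict words, digests (parse-level); instance-dependent `ρ / τ / x̄`; the upper side.  No named facts, no
instances, no `sorry`; everything stated is proved.
-/

namespace Literature.Computation.Certificates

open Matrix Finset
open scoped BigOperators

namespace ConicLayout

/-! ### §0 Plumbing (generic finite types; local copies of the siblings' private lemmas) -/

/-- `tr (Z F) = ⟨Z, F⟩` after casting to `ℝ`. [folklore] -/
private theorem trace_map_mul_map₃ {m : Type*} [Fintype m] (Z F : Matrix m m ℚ) :
    trace (Z.map (Rat.cast : ℚ → ℝ) * F.map (Rat.cast : ℚ → ℝ)) = (pairing Z F : ℝ) := by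
  simp [Matrix.trace, Matrix.mul_apply, pairing, Rat.cast_sum, Rat.cast_mul]

/-- `|Σ_j a_j d_j| ≤ Σ_j |a_j| r_j` when `|d_j| ≤ r_j`. [folklore] -/
private theorem abs_sum_mul_le₃ {n : Type*} [Fintype n] {a d r : n → ℝ} (h : ∀ j, |d j| ≤ r j) :
    |∑ j, a j * d j| ≤ ∑ j, |a j| * r j :=
  (Finset.abs_sum_le_sum_abs _ _).trans (Finset.sum_le_sum fun j _ => by
    rw [abs_mul]; exact mul_le_mul_of_nonneg_left (h j) (abs_nonneg _))

/-- `|tr(Z F′) − tr(Z F)| ≤ Σ_a Σ_b |Z_ab| R_ba` when `|F′ − F| ≤ R` entrywise. [folklore] -/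
private theorem abs_trace_mul_sub_le₃ {m : Type*} [Fintype m] (Z : Matrix m m ℚ)
    {F' F : Matrix m m ℝ} {R : Matrix m m ℚ} (h : ∀ a b, |F' a b - F a b| ≤ (R a b : ℝ)) :
    |trace (Z.map (Rat.cast : ℚ → ℝ) * F') - trace (Z.map (Rat.cast : ℚ → ℝ) * F)| ≤
      (absPairing Z R : ℝ) := by
  have hdiff : trace (Z.map (Rat.cast : ℚ → ℝ) * F') - trace (Z.map (Rat.cast : ℚ → ℝ) * F) =
      ∑ a, ∑ b, (Z a b : ℝ) * (F' b a - F b a) := by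
    simp only [Matrix.trace, Matrix.diag_apply, Matrix.mul_apply, Matrix.map_apply, mul_sub,
      Finset.sum_sub_distrib]
  rw [hdiff, absPairing, Rat.cast_sum]
  refine (Finset.abs_sum_le_sum_abs _ _).trans (Finset.sum_le_sum fun a _ => ?_)
  rw [Rat.cast_sum]
  refine (abs_sum_mul_le₃ (a := fun b => (Z a b : ℝ)) fun b => h b a).trans (le_of_eq ?_)
  simp [Rat.cast_mul, Rat.cast_abs]

/-- `splitGram = W Wᵀ` over `ℝ` for the optional split (`W = 2^{-K} W_rows`). [folklore] -/
private theorem splitGram_map_eq₃ {m l : Type*} [Fintype l] (o : Option (NegSplit m l)) :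
    (splitGram o).map (Rat.cast : ℚ → ℝ) = splitReal o * (splitReal o)ᵀ := by
  cases o with
  | none => ext a b; simp [splitGram, splitReal]
  | some s =>
      ext a b
      have h4 : (4 : ℝ) ^ s.expo = (2 : ℝ) ^ s.expo * (2 : ℝ) ^ s.expo := by rw [← mul_pow]; norm_num
      simp only [splitGram, splitReal, NegSplit.gram, NegSplit.real, Matrix.map_apply,
        Matrix.mul_apply, Matrix.smul_apply, Matrix.transpose_apply, smul_eq_mul, Rat.cast_div,
        Rat.cast_sum, Rat.cast_mul, Rat.cast_intCast, Rat.cast_pow, Rat.cast_ofNat]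
      simp_rw [mul_mul_mul_comm ((2 : ℝ) ^ s.expo)⁻¹ _ ((2 : ℝ) ^ s.expo)⁻¹ _]
      rw [← Finset.mul_sum, h4, div_eq_inv_mul, mul_inv]

/-- `splitFrob = tr(Wᵀ W)` over `ℝ` for the optional split. [folklore] -/
private theorem splitFrob_eq₃ {m l : Type*} [Fintype m] [Fintype l] (o : Option (NegSplit m l)) :
    (splitFrob o : ℝ) = trace ((splitReal o)ᵀ * splitReal o) := by
  cases o with
  | none => simp [splitFrob, splitReal]
  | some s =>
      have h4 : (4 : ℝ) ^ s.expo = (2 : ℝ) ^ s.expo * (2 : ℝ) ^ s.expo := by rw [← mul_pow]; norm_num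
      simp only [splitFrob, splitReal, NegSplit.frob, NegSplit.real, Matrix.trace, Matrix.diag,
        Matrix.mul_apply, Matrix.transpose_apply, Matrix.smul_apply, Matrix.map_apply, smul_eq_mul,
        Rat.cast_div, Rat.cast_sum, Rat.cast_mul, Rat.cast_intCast, Rat.cast_pow, Rat.cast_ofNat]
      rw [Finset.sum_comm]
      simp_rw [mul_mul_mul_comm ((2 : ℝ) ^ s.expo)⁻¹ _ ((2 : ℝ) ^ s.expo)⁻¹ _]
      rw [h4, div_eq_inv_mul, mul_inv, Finset.mul_sum]
      exact Finset.sum_congr rfl fun j _ => by rw [Finset.mul_sum]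

/-- `λ_max(A) ≤ tr A` for a real `A ⪰ 0`, in Loewner form `(tr A) · 1 − A ⪰ 0` (spectral theorem). [folklore] -/
private theorem posSemidef_trace_smul_one_sub_real₃ {m : Type*} [Fintype m] [DecidableEq m]
    {A : Matrix m m ℝ} (hA : A.PosSemidef) : (A.trace • (1 : Matrix m m ℝ) - A).PosSemidef := by
  have hH : A.IsHermitian := hA.1
  set U : Matrix m m ℝ := (hH.eigenvectorUnitary : Matrix m m ℝ) with hU
  have h1 : U * star U = 1 := Matrix.mem_unitaryGroup_iff.1 hH.eigenvectorUnitary.2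
  have hspec : A = U * diagonal (RCLike.ofReal ∘ hH.eigenvalues) * star U := by
    have hs := hH.spectral_theorem
    rw [Unitary.conjStarAlgAut_apply] at hs
    simpa [hU] using hs
  have hsum : A.trace = ∑ i, hH.eigenvalues i := by simpa using hH.trace_eq_sum_eigenvalues
  have hD : (diagonal fun i => A.trace - hH.eigenvalues i).PosSemidef := by
    rw [posSemidef_diagonal_iff]
    intro i
    rw [hsum]
    exact sub_nonneg.2 (Finset.single_le_sum (fun j _ => hA.eigenvalues_nonneg j) (Finset.mem_univ i))
  have hdiag : (diagonal fun i => A.trace - hH.eigenvalues i) =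
      A.trace • (1 : Matrix m m ℝ) - diagonal (RCLike.ofReal ∘ hH.eigenvalues) := by
    ext i j
    by_cases hij : i = j
    · subst hij; simp
    · simp [hij]
  have key : A.trace • (1 : Matrix m m ℝ) - A =
      U * (diagonal fun i => A.trace - hH.eigenvalues i) * Uᴴ := by
    rw [hdiag, Matrix.mul_sub, Matrix.sub_mul, Matrix.mul_smul, Matrix.mul_one, Matrix.smul_mul,
      ← star_eq_conjTranspose, h1, ← hspec]
  rw [key]
  exact hD.mul_mul_conjTranspose_same U

variable {V E I K : Type*} [Fintype V] [DecidableEq V] [Fintype E] [Fintype I] [Fintype K]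
variable {σ : K → Type*} [∀ k, Fintype (σ k)] [∀ k, DecidableEq (σ k)]
variable {π : K → Type*} [∀ k, Fintype (π k)]
variable {ω : K → Type*} [∀ k, Fintype (ω k)]

/-! ### §1 Operator bounds for an instance -/

/-- The document's declared OPERATOR BOUNDS `x̄_k · 1 − M′_k(y) ⪰ 0` (`lambda_max_bound`, where present)
for the INSTANCE's blocks at `y` — client-vouched, uniform over the box (FORMAT §2 «the SAME … operator
bounds x̄_k for every instance»). [cite: Jansson2007, Cor 6.1 (ii), p. 13: «X(ε) ≤ x̄ · I»] -/
def RealData.OpBounds (P : ProblemOp V E I K σ) (D : RealData V E I K σ) (y : V → ℝ) : Prop :=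
  ∀ k, ∀ q ∈ P.lamMax k, ((q : ℝ) • (1 : Matrix (σ k) (σ k) ℝ) - D.block k y).PosSemidef

/-! ### §2 The box claim of a split lower certificate and its acceptance -/

namespace LowerCertNS

/-- `L_v` for GIVEN block multipliers `Z_k` (two-stage evaluation):
`rad(c_v) + Σ_e |λ_e| rad(row_e[v]) + Σ_i κ_i rad(row_i[v]) + Σ_k Σ_{a,b} |Z_k[a,b]| rad(F_{k,v}[b,a])`.
[folklore] -/
def boxLWith (R : Radii V E I K σ) (C : LowerCertNS V E I K σ π ω) (Zs : ∀ k, Matrix (σ k) (σ k) ℚ)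
    (v : V) : ℚ :=
  R.c v + ∑ e, |C.lam e| * R.rowE e v + ∑ i, C.kap i * R.rowI i v + ∑ k, absPairing (Zs k) (R.F k v)

/-- `L_v` with the certificate's split multipliers `Z_k = P_k − W_k W_kᵀ` (FORMAT §4 (ii)). [folklore] -/
def boxL (R : Radii V E I K σ) (C : LowerCertNS V E I K σ π ω) (v : V) : ℚ :=
  boxLWith R C C.Zm v

/-- `L_β` for given block multipliers: `rad(c₀) + L_u + Σ_e |λ_e| rad(rhs_e) + Σ_i κ_i rad(upper_i) +
Σ_k Σ_{a,b} |Z_k[a,b]| rad(C_k[b,a])`. [folklore] -/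
def boxLbetaWith (P : ProblemOp V E I K σ) (R : Radii V E I K σ) (C : LowerCertNS V E I K σ π ω)
    (Zs : ∀ k, Matrix (σ k) (σ k) ℚ) : ℚ :=
  R.c0 + boxLWith R C Zs P.unit + ∑ e, |C.lam e| * R.rhs e + ∑ i, C.kap i * R.upper i +
    ∑ k, absPairing (Zs k) (R.Cb k)

/-- `L_β` with the certificate's split multipliers. [folklore] -/
def boxLbeta (P : ProblemOp V E I K σ) (R : Radii V E I K σ) (C : LowerCertNS V E I K σ π ω) : ℚ :=
  boxLbetaWith P R C C.Zm

/-- `box_penalty = L_β + Σ_{v ≠ u} ρ_v L_v` RECOMPUTED for given multipliers (free `v`: `0`). [folklore] -/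
def boxPenaltyWith (P : ProblemOp V E I K σ) (R : Radii V E I K σ) (C : LowerCertNS V E I K σ π ω)
    (Zs : ∀ k, Matrix (σ k) (σ k) ℚ) : ℚ :=
  boxLbetaWith P R C Zs + ∑ v ∈ univ.erase P.unit, (P.rho v).getD 0 * boxLWith R C Zs v

/-- `box_penalty` recomputed with the certificate's split multipliers. [folklore] -/
def boxPenalty (P : ProblemOp V E I K σ) (R : Radii V E I K σ) (C : LowerCertNS V E I K σ π ω) : ℚ :=
  boxPenaltyWith P R C C.Zm

end LowerCertNS

/-- A split lower certificate WITH A BOX CLAIM (`certsdp-conic/1` listing `neg_split` and `interval_box`):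
the split certificate plus the pinned sub-claims `claimed.box_penalty`, `claimed.lower_bound_box`.
[cite: Jansson2007, remark after (4.3), p. 9] -/
structure LowerCertNSBox (V E I K : Type*) (σ π ω : K → Type*) extends LowerCertNS V E I K σ π ω where
  /-- `claimed.box_penalty` -/ boxPenaltyClaimed : ℚ
  /-- `claimed.lower_bound_box` -/ lowerBoundBox : ℚ

namespace LowerCertNSBox

/-- **Acceptance, for given block multipliers** (second stage): `LowerCertNS.checkWith` ∧ §4 (v) no
radius on a free variable's column ∧ §4 (iii) the two sub-claims EQUAL their recomputation. [folklore] -/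
def checkWith (P : ProblemOp V E I K σ) (R : Radii V E I K σ) (C : LowerCertNSBox V E I K σ π ω)
    (Zs : ∀ k, Matrix (σ k) (σ k) ℚ) : Bool :=
  LowerCertNS.checkWith P C.toLowerCertNS Zs &&
    decide (∀ v, v ≠ P.unit → P.rho v = none → LowerCertNS.boxLWith R C.toLowerCertNS Zs v = 0) &&
    decide (C.boxPenaltyClaimed = LowerCertNS.boxPenaltyWith P R C.toLowerCertNS Zs) &&
    decide (C.lowerBoundBox = C.lowerBound - C.boxPenaltyClaimed)

/-- **Acceptance of a box-claiming split certificate** = `checkWith` at the certificate's own multipliers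
`Z_k = P_k − W_k W_kᵀ` (`check = checkWith … Zm` by `rfl`, for two-stage kernel replays). [folklore] -/
def check (P : ProblemOp V E I K σ) (R : Radii V E I K σ) (C : LowerCertNSBox V E I K σ π ω) : Bool :=
  checkWith P R C C.Zm

omit [Fintype V] [DecidableEq V] [∀ k, DecidableEq (σ k)] [∀ k, Fintype (π k)] [∀ k, Fintype (ω k)] in
/-- The residual of an instance (given multipliers) differs from the midpoint residual by at most `L_v`
(`κ ≥ 0`). [folklore] -/
private theorem abs_residualWith_sub_le {P : ProblemOp V E I K σ} {R : Radii V E I K σ}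
    {C : LowerCertNS V E I K σ π ω} (hκ : ∀ i, 0 ≤ C.kap i) {D : RealData V E I K σ}
    (hD : D.InBox P.toProblem R) (Zs : ∀ k, Matrix (σ k) (σ k) ℚ) (v : V) :
    |(D.c v - ∑ e, (C.lam e : ℝ) * D.rowE e v + ∑ i, (C.kap i : ℝ) * D.rowI i v -
        ∑ k, trace ((Zs k).map (Rat.cast : ℚ → ℝ) * D.F k v)) -
        (LowerCertNS.residualWith P C Zs v : ℝ)| ≤ (LowerCertNS.boxLWith R C Zs v : ℝ) := by
  have hc := hD.c v
  have hE : |∑ e, (C.lam e : ℝ) * D.rowE e v - ∑ e, (C.lam e : ℝ) * (P.rowE e v : ℝ)| ≤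
      ∑ e, |(C.lam e : ℝ)| * (R.rowE e v : ℝ) := by
    rw [← Finset.sum_sub_distrib]; simp_rw [← mul_sub]; exact abs_sum_mul_le₃ fun e => hD.rowE e v
  have hI : |∑ i, (C.kap i : ℝ) * D.rowI i v - ∑ i, (C.kap i : ℝ) * (P.rowI i v : ℝ)| ≤
      ∑ i, (C.kap i : ℝ) * (R.rowI i v : ℝ) := by
    rw [← Finset.sum_sub_distrib]; simp_rw [← mul_sub]
    refine (abs_sum_mul_le₃ fun i => hD.rowI i v).trans (le_of_eq (Finset.sum_congr rfl fun i _ => ?_))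
    rw [abs_of_nonneg (show (0 : ℝ) ≤ (C.kap i : ℝ) by exact_mod_cast hκ i)]
  have hK : |∑ k, trace ((Zs k).map (Rat.cast : ℚ → ℝ) * D.F k v) -
      ∑ k, trace ((Zs k).map (Rat.cast : ℚ → ℝ) * (P.F k v).map (Rat.cast : ℚ → ℝ))| ≤
      ∑ k, (absPairing (Zs k) (R.F k v) : ℝ) := by
    rw [← Finset.sum_sub_distrib]
    exact (Finset.abs_sum_le_sum_abs _ _).trans (Finset.sum_le_sum fun k _ =>
      abs_trace_mul_sub_le₃ _ fun a b => by simpa only [Matrix.map_apply] using hD.F k v a b)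
  have hres : (LowerCertNS.residualWith P C Zs v : ℝ) = (P.c v : ℝ) -
      ∑ e, (C.lam e : ℝ) * (P.rowE e v : ℝ) + ∑ i, (C.kap i : ℝ) * (P.rowI i v : ℝ) -
      ∑ k, trace ((Zs k).map (Rat.cast : ℚ → ℝ) * (P.F k v).map (Rat.cast : ℚ → ℝ)) := by
    simp only [LowerCertNS.residualWith, Rat.cast_sub, Rat.cast_add, Rat.cast_sum, Rat.cast_mul,
      trace_map_mul_map₃]
  have hL : (LowerCertNS.boxLWith R C Zs v : ℝ) = (R.c v : ℝ) + ∑ e, |(C.lam e : ℝ)| * (R.rowE e v : ℝ) +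
      ∑ i, (C.kap i : ℝ) * (R.rowI i v : ℝ) + ∑ k, (absPairing (Zs k) (R.F k v) : ℝ) := by
    simp only [LowerCertNS.boxLWith, Rat.cast_add, Rat.cast_sum, Rat.cast_mul, Rat.cast_abs]
  rw [hres, hL, abs_le]
  rw [abs_le] at hc hE hI hK
  constructor <;> linarith [hc.1, hc.2, hE.1, hE.2, hI.1, hI.2, hK.1, hK.2]

omit [Fintype V] [DecidableEq V] [∀ k, DecidableEq (σ k)] [∀ k, Fintype (π k)] [∀ k, Fintype (ω k)] in
/-- `β` of an instance (given multipliers) is within `L_β` of the midpoint `β` (`κ ≥ 0`). [folklore] -/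
private theorem abs_betaWith_sub_le {P : ProblemOp V E I K σ} {R : Radii V E I K σ}
    {C : LowerCertNS V E I K σ π ω} (hκ : ∀ i, 0 ≤ C.kap i) {D : RealData V E I K σ}
    (hD : D.InBox P.toProblem R) (Zs : ∀ k, Matrix (σ k) (σ k) ℚ) :
    |(D.c0 + (D.c P.unit - ∑ e, (C.lam e : ℝ) * D.rowE e P.unit + ∑ i, (C.kap i : ℝ) * D.rowI i P.unit -
        ∑ k, trace ((Zs k).map (Rat.cast : ℚ → ℝ) * D.F k P.unit)) +
        ∑ e, (C.lam e : ℝ) * D.rhs e - ∑ i, (C.kap i : ℝ) * D.upper i -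
        ∑ k, trace ((Zs k).map (Rat.cast : ℚ → ℝ) * D.Cb k)) - (LowerCertNS.betaWith P C Zs : ℝ)| ≤
      (LowerCertNS.boxLbetaWith P R C Zs : ℝ) := by
  have hc0 := hD.c0
  have hu := abs_residualWith_sub_le hκ hD Zs P.unit
  have hE : |∑ e, (C.lam e : ℝ) * D.rhs e - ∑ e, (C.lam e : ℝ) * (P.rhs e : ℝ)| ≤
      ∑ e, |(C.lam e : ℝ)| * (R.rhs e : ℝ) := by
    rw [← Finset.sum_sub_distrib]; simp_rw [← mul_sub]; exact abs_sum_mul_le₃ fun e => hD.rhs e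
  have hI : |∑ i, (C.kap i : ℝ) * D.upper i - ∑ i, (C.kap i : ℝ) * (P.upper i : ℝ)| ≤
      ∑ i, (C.kap i : ℝ) * (R.upper i : ℝ) := by
    rw [← Finset.sum_sub_distrib]; simp_rw [← mul_sub]
    refine (abs_sum_mul_le₃ fun i => hD.upper i).trans (le_of_eq (Finset.sum_congr rfl fun i _ => ?_))
    rw [abs_of_nonneg (show (0 : ℝ) ≤ (C.kap i : ℝ) by exact_mod_cast hκ i)]
  have hK : |∑ k, trace ((Zs k).map (Rat.cast : ℚ → ℝ) * D.Cb k) -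
      ∑ k, trace ((Zs k).map (Rat.cast : ℚ → ℝ) * (P.Cb k).map (Rat.cast : ℚ → ℝ))| ≤
      ∑ k, (absPairing (Zs k) (R.Cb k) : ℝ) := by
    rw [← Finset.sum_sub_distrib]
    exact (Finset.abs_sum_le_sum_abs _ _).trans (Finset.sum_le_sum fun k _ =>
      abs_trace_mul_sub_le₃ _ fun a b => by simpa only [Matrix.map_apply] using hD.Cb k a b)
  have hbeta : (LowerCertNS.betaWith P C Zs : ℝ) = (P.c0 : ℝ) +
      (LowerCertNS.residualWith P C Zs P.unit : ℝ) +
      ∑ e, (C.lam e : ℝ) * (P.rhs e : ℝ) - ∑ i, (C.kap i : ℝ) * (P.upper i : ℝ) -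
      ∑ k, trace ((Zs k).map (Rat.cast : ℚ → ℝ) * (P.Cb k).map (Rat.cast : ℚ → ℝ)) := by
    simp only [LowerCertNS.betaWith, Rat.cast_sub, Rat.cast_add, Rat.cast_sum, Rat.cast_mul,
      trace_map_mul_map₃]
  have hL : (LowerCertNS.boxLbetaWith P R C Zs : ℝ) = (R.c0 : ℝ) +
      (LowerCertNS.boxLWith R C Zs P.unit : ℝ) + ∑ e, |(C.lam e : ℝ)| * (R.rhs e : ℝ) +
      ∑ i, (C.kap i : ℝ) * (R.upper i : ℝ) + ∑ k, (absPairing (Zs k) (R.Cb k) : ℝ) := by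
    simp only [LowerCertNS.boxLbetaWith, Rat.cast_add, Rat.cast_sum, Rat.cast_mul, Rat.cast_abs]
  rw [hbeta, hL, abs_le]
  rw [abs_le] at hc0 hu hE hI hK
  constructor <;> linarith [hc0.1, hc0.2, hu.1, hu.2, hE.1, hE.2, hI.1, hI.2, hK.1, hK.2]

/-- The core estimate: an accepted box-claiming split certificate bounds the objective of every instance
of the box at every point feasible for that instance satisfying the declared operator bounds, given real
trace majorants whose penalty is covered by the certificate's. [cite: Jansson2007, Thm 4.1 (a) (p0008),
Cor 6.1 (a) (p0013) and remark after (4.3), p. 9] [cite: JanssonChaykinKeil2008, Lemma 3.1 and Thm 3.2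
(interval input data)] -/
private theorem bound_core {P : ProblemOp V E I K σ} {R : Radii V E I K σ}
    {C : LowerCertNSBox V E I K σ π ω} (h : check P R C = true) {D : RealData V E I K σ}
    (hD : D.InBox P.toProblem R) {y : V → ℝ} (hy : D.Feasible P.toProblem y) (hop : D.OpBounds P y)
    (τ : K → ℝ) (hτ : ∀ k, (D.block k y).trace ≤ τ k)
    (hpen : ∑ k, |min 0 ((C.wit k).dfloor : ℝ)| * τ k ≤ (LowerCertNS.penalty P C.toLowerCertNS : ℝ)) :
    (C.lowerBoundBox : ℝ) ≤ D.obj y := by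
  simp only [check, checkWith, LowerCertNS.checkWith, Bool.and_eq_true, decide_eq_true_eq] at h
  obtain ⟨⟨⟨⟨⟨⟨⟨⟨hκ, hnone⟩, hrows⟩, _⟩, hsplit⟩, hlb⟩, hfree⟩, hbp⟩, hlbb⟩ := h
  -- box of `y`: `ρ_v`, or `|y_v|` for a free variable (`r_v = L_v = 0`); operator bound: `x̄_k` or `tr`
  let ρ : V → ℝ := fun v => (P.rho v).elim |y v| fun q => (q : ℝ)
  have hρ : ∀ v, v ≠ P.unit → |y v| ≤ ρ v := fun v _ => by
    cases hq : P.rho v with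
    | none => simp [ρ, hq]
    | some q => simpa [ρ, hq] using hy.box v q (by simp [hq])
  let xb : K → ℝ := fun k => (P.lamMax k).elim (D.block k y).trace fun q => (q : ℝ)
  have hxb : ∀ k, (xb k • (1 : Matrix (σ k) (σ k) ℝ) - D.block k y).PosSemidef := fun k => by
    cases hq : P.lamMax k with
    | none => simpa [xb, hq] using posSemidef_trace_smul_one_sub_real₃ (hy.psd k)
    | some q => simpa [xb, hq] using hop k q (by simp [hq])
  -- the certified parts dominate their floors: `Z_k + W_k W_kᵀ = P_k ⪰ d_k · 1`
  have hZ : ∀ k, ((C.toLowerCertNS.Zm k).map (Rat.cast : ℚ → ℝ) +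
      splitReal (C.split k) * (splitReal (C.split k))ᵀ -
      ((C.wit k).dfloor : ℝ) • (1 : Matrix (σ k) (σ k) ℝ)).PosSemidef := fun k => by
    have e : (C.toLowerCertNS.Zm k).map (Rat.cast : ℚ → ℝ) +
        splitReal (C.split k) * (splitReal (C.split k))ᵀ = (C.wit k).Z.map (Rat.cast : ℚ → ℝ) := by
      rw [← splitGram_map_eq₃]
      ext a b
      simp [LowerCertNS.Zm]
    rw [e]
    exact (C.wit k).posSemidef_sub_dfloor (hrows k)
  -- `lmiForm_bound_negSplit` for the INSTANCE with its own exact residuals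
  have hmain := JanssonChaykinKeil.lmiForm_bound_negSplit D.c D.c0 P.unit D.rowE D.rhs D.rowI D.upper
    D.Cb D.F ρ τ xb hy.unit hρ hy.eq hy.le hy.psd hτ hxb
    (fun e => (C.lam e : ℝ)) (fun i => (C.kap i : ℝ)) (fun i => by exact_mod_cast hκ i)
    (fun k => (C.toLowerCertNS.Zm k).map (Rat.cast : ℚ → ℝ)) (fun k => splitReal (C.split k))
    (fun k => ((C.wit k).dfloor : ℝ)) hZ
    (fun v => D.c v - ∑ e, (C.lam e : ℝ) * D.rowE e v + ∑ i, (C.kap i : ℝ) * D.rowI i v -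
      ∑ k, trace ((C.toLowerCertNS.Zm k).map (Rat.cast : ℚ → ℝ) * D.F k v))
    (fun _ => rfl) _ rfl
  -- weaken the instance residuals to the midpoint's: `|r′_v| ≤ |r_v| + L_v`, `β′ ≥ β − L_β`
  have hR : ∀ v, v ≠ P.unit →
      |D.c v - ∑ e, (C.lam e : ℝ) * D.rowE e v + ∑ i, (C.kap i : ℝ) * D.rowI i v -
          ∑ k, trace ((C.toLowerCertNS.Zm k).map (Rat.cast : ℚ → ℝ) * D.F k v)| * ρ v ≤
        ((|LowerCertNS.residual P C.toLowerCertNS v| +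
          LowerCertNS.boxL R C.toLowerCertNS v : ℚ) : ℝ) * ρ v := fun v hv => by
    have h1 := abs_residualWith_sub_le (P := P) hκ hD C.toLowerCertNS.Zm v
    have h2 := abs_sub_abs_le_abs_sub
      (D.c v - ∑ e, (C.lam e : ℝ) * D.rowE e v + ∑ i, (C.kap i : ℝ) * D.rowI i v -
        ∑ k, trace ((C.toLowerCertNS.Zm k).map (Rat.cast : ℚ → ℝ) * D.F k v))
      (LowerCertNS.residualWith P C.toLowerCertNS C.toLowerCertNS.Zm v : ℝ)
    refine mul_le_mul_of_nonneg_right ?_ ((abs_nonneg _).trans (hρ v hv))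
    simp only [LowerCertNS.residual, LowerCertNS.boxL]
    push_cast
    linarith
  have hβ := abs_betaWith_sub_le (P := P) hκ hD C.toLowerCertNS.Zm
  rw [abs_le] at hβ
  have hsumle := Finset.sum_le_sum fun v (hv : v ∈ univ.erase P.unit) =>
    hR v (Finset.ne_of_mem_erase hv)
  -- `Σ_{v≠u} (|r_v| + L_v) ρ_v = ℓ₁ + Σ_{v≠u} ρ_v L_v` (free variables: both sides `0`)
  have hsumR : ∑ v ∈ univ.erase P.unit, ((|LowerCertNS.residual P C.toLowerCertNS v| +
        LowerCertNS.boxL R C.toLowerCertNS v : ℚ) : ℝ) * ρ v =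
      (LowerCertNS.l1 P C.toLowerCertNS : ℝ) + ∑ v ∈ univ.erase P.unit,
        (((P.rho v).getD 0 * LowerCertNS.boxL R C.toLowerCertNS v : ℚ) : ℝ) := by
    rw [LowerCertNS.l1, LowerCertNS.l1With, Rat.cast_sum, ← Finset.sum_add_distrib]
    refine Finset.sum_congr rfl fun v hv => ?_
    have hvu : v ≠ P.unit := Finset.ne_of_mem_erase hv
    cases hq : P.rho v with
    | none =>
        have h0 : LowerCertNS.boxL R C.toLowerCertNS v = 0 := hfree v hvu hq
        simp [LowerCertNS.residual, hnone v hvu hq, h0]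
    | some q =>
        simp only [ρ, hq, Option.elim_some, Option.getD_some, LowerCertNS.residual, Rat.cast_add,
          Rat.cast_mul, Rat.cast_abs]
        ring
  -- the split penalty of the certificate IS `Σ_k x̄_k tr(W_kᵀ W_k)` (a split block carries `x̄_k`, N-2)
  have hns : (LowerCertNS.nsPenalty P C.toLowerCertNS : ℝ) =
      ∑ k, xb k * trace ((splitReal (C.split k))ᵀ * splitReal (C.split k)) := by
    rw [LowerCertNS.nsPenalty, Rat.cast_sum]
    refine Finset.sum_congr rfl fun k _ => ?_
    rw [Rat.cast_mul, splitFrob_eq₃]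
    cases hs : C.split k with
    | none => simp [splitReal]
    | some s =>
        obtain ⟨_, hsome⟩ := hsplit k (by simp [hs])
        obtain ⟨q, hq⟩ := Option.isSome_iff_exists.1 hsome
        simp [xb, hq]
  have hbp' : (C.boxPenaltyClaimed : ℝ) = (LowerCertNS.boxLbeta P R C.toLowerCertNS : ℝ) +
      ∑ v ∈ univ.erase P.unit, (((P.rho v).getD 0 * LowerCertNS.boxL R C.toLowerCertNS v : ℚ) : ℝ) := by
    rw [hbp]
    simp only [LowerCertNS.boxPenaltyWith, LowerCertNS.boxLbeta, LowerCertNS.boxL, Rat.cast_add,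
      Rat.cast_sum]
  have hlb' : (C.lowerBound : ℝ) ≤ (LowerCertNS.beta P C.toLowerCertNS : ℝ) -
      (LowerCertNS.l1 P C.toLowerCertNS : ℝ) - (LowerCertNS.penalty P C.toLowerCertNS : ℝ) -
      (LowerCertNS.nsPenalty P C.toLowerCertNS : ℝ) := by
    simp only [LowerCertNS.beta, LowerCertNS.l1]
    exact_mod_cast hlb
  have hlbb' : (C.lowerBoundBox : ℝ) = (C.lowerBound : ℝ) - (C.boxPenaltyClaimed : ℝ) := by
    rw [hlbb, Rat.cast_sub]
  have hbeta' : (LowerCertNS.beta P C.toLowerCertNS : ℝ) =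
      (LowerCertNS.betaWith P C.toLowerCertNS C.toLowerCertNS.Zm : ℝ) := rfl
  have hLb' : (LowerCertNS.boxLbeta P R C.toLowerCertNS : ℝ) =
      (LowerCertNS.boxLbetaWith P R C.toLowerCertNS C.toLowerCertNS.Zm : ℝ) := rfl
  rw [hsumR] at hsumle
  rw [hns] at hlb'
  rw [hlbb', RealData.obj]
  linarith [hβ.1]

/-- **Soundness of the box claim with splits**: if a box-claiming split certificate is accepted, then
`claimed.lower_bound_box ≤ c′·y + c₀′` for EVERY instance `d′` of the entrywise box and every `y`
feasible FOR THAT INSTANCE at which the declared a-priori trace bounds AND operator bounds hold.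
[cite: Jansson2007, Thm 4.1 (a) (p0008), Cor 6.1 (a) (p0013) and remark after (4.3), p. 9]
[cite: JanssonChaykinKeil2008, Lemma 3.1 and Thm 3.2 (interval input data)]
[cite: Rump1999VerifiedLargeSystems, §4, Algorithm 4.1 step 7] -/
theorem sound {P : ProblemOp V E I K σ} {R : Radii V E I K σ} {C : LowerCertNSBox V E I K σ π ω}
    (h : check P R C = true) {D : RealData V E I K σ} (hD : D.InBox P.toProblem R) {y : V → ℝ}
    (hy : D.Feasible P.toProblem y) (htr : D.TraceBounds P.toProblem y) (hop : D.OpBounds P y) :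
    (C.lowerBoundBox : ℝ) ≤ D.obj y := by
  have hsome : ∀ k, (C.wit k).dfloor < 0 → (P.tau k).isSome = true := by
    have h' := h
    simp only [check, checkWith, LowerCertNS.checkWith, Bool.and_eq_true, decide_eq_true_eq] at h'
    exact h'.1.1.1.1.1.2
  let τ : K → ℝ := fun k => (P.tau k).elim (D.block k y).trace fun q => (q : ℝ)
  refine bound_core h hD hy hop τ (fun k => ?_) (le_of_eq ?_)
  · cases hq : P.tau k with
    | none => simp [τ, hq]
    | some q => simpa [τ, hq] using htr k q (by simp [hq])
  · rw [LowerCertNS.penalty, Rat.cast_sum]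
    refine Finset.sum_congr rfl fun k _ => ?_
    cases hq : P.tau k with
    | none =>
        have h0 : 0 ≤ (C.wit k).dfloor := by
          by_contra hlt
          have := hsome k (lt_of_not_ge hlt)
          simp [hq] at this
        have h0' : (0 : ℝ) ≤ ((C.wit k).dfloor : ℝ) := by exact_mod_cast h0
        simp [min_eq_left h0', min_eq_left h0]
    | some q => simp [τ, hq, Rat.cast_mul, Rat.cast_abs, Rat.cast_min]

/-- **Soundness without trace bounds**: if every eigenvalue floor of the certified parts is `≥ 0` (pure
Gram `P_k`), the box bound holds at every point feasible for the instance satisfying the declared operator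
bounds. [cite: Jansson2007, Thm 4.1 (a) (p0008) and remark after (4.3), p. 9]
[cite: BurerMonteiro2003, §1 eq. (2)] -/
theorem sound' {P : ProblemOp V E I K σ} {R : Radii V E I K σ} {C : LowerCertNSBox V E I K σ π ω}
    (h : check P R C = true) (h0 : ∀ k, 0 ≤ (C.wit k).dfloor) {D : RealData V E I K σ}
    (hD : D.InBox P.toProblem R) {y : V → ℝ} (hy : D.Feasible P.toProblem y) (hop : D.OpBounds P y) :
    (C.lowerBoundBox : ℝ) ≤ D.obj y := by
  refine bound_core h hD hy hop (fun k => (D.block k y).trace) (fun k => le_rfl) ?_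
  have hl : ∑ k, |min 0 ((C.wit k).dfloor : ℝ)| * (D.block k y).trace = 0 :=
    Finset.sum_eq_zero fun k _ => by
      rw [min_eq_left (show (0 : ℝ) ≤ ((C.wit k).dfloor : ℝ) by exact_mod_cast h0 k), abs_zero,
        zero_mul]
  have hr : LowerCertNS.penalty P C.toLowerCertNS = 0 :=
    Finset.sum_eq_zero fun k _ => by rw [min_eq_left (h0 k), abs_zero, zero_mul]
  rw [hl, hr, Rat.cast_zero]

/-- The accepted box bound is below the INFIMUM of the instance's objective over the points feasible for
the instance that satisfy the declared trace and operator bounds (nonempty such set).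
[cite: Jansson2007, Thm 4.1 (a) (p0008) and remark after (4.3), p. 9] -/
theorem le_csInf {P : ProblemOp V E I K σ} {R : Radii V E I K σ} {C : LowerCertNSBox V E I K σ π ω}
    (h : check P R C = true) {D : RealData V E I K σ} (hD : D.InBox P.toProblem R)
    (hne : (D.obj '' {y | D.Feasible P.toProblem y ∧ D.TraceBounds P.toProblem y ∧
      D.OpBounds P y}).Nonempty) :
    (C.lowerBoundBox : ℝ) ≤
      sInf (D.obj '' {y | D.Feasible P.toProblem y ∧ D.TraceBounds P.toProblem y ∧ D.OpBounds P y}) :=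
  _root_.le_csInf hne (by rintro _ ⟨y, ⟨hy, htr, hop⟩, rfl⟩; exact sound h hD hy htr hop)

/-- Without penalised blocks: the accepted box bound is below the infimum of the instance's objective over
the points feasible for the instance satisfying the declared operator bounds.
[cite: Jansson2007, Thm 4.1 (a) (p0008) and remark after (4.3), p. 9] -/
theorem le_csInf' {P : ProblemOp V E I K σ} {R : Radii V E I K σ} {C : LowerCertNSBox V E I K σ π ω}
    (h : check P R C = true) (h0 : ∀ k, 0 ≤ (C.wit k).dfloor) {D : RealData V E I K σ}
    (hD : D.InBox P.toProblem R)
    (hne : (D.obj '' {y | D.Feasible P.toProblem y ∧ D.OpBounds P y}).Nonempty) :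
    (C.lowerBoundBox : ℝ) ≤ sInf (D.obj '' {y | D.Feasible P.toProblem y ∧ D.OpBounds P y}) :=
  _root_.le_csInf hne (by rintro _ ⟨y, ⟨hy, hop⟩, rfl⟩; exact sound' h h0 hD hy hop)

end LowerCertNSBox

end ConicLayout

end Literature.Computation.Certificates
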